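import Summits.RiemannHypothesis.RiemannHypothesis.Theorems.Splittings.RobinFiniteStairSqrt
import Literature.NumberTheory.LFunctions.RiemannHypothesisUpTo100000X
import HarnessLib

/-!
# RobinFiniteStairSqrtCert — g18 «THE WHOLE STAIRCASE», composition add-on 2/2

The print-only composed rows (proposal class `computational`, compiled RS certificate `riemannHypothesisUpTo_100000`):
`robinCA_below_stairS_cert : robinCA_below 583000001` and `robin_le_of_certS : ∀ n, 5040 < n → n ≤ 10^(25·10⁷) → robinInequality n` from
{Büthe 2018 Thm 2, BKLNW 2021} ALONE (tree: `robinCA_below_483000001`, `robinInequality_le_ten_pow_209600000` from the same two prints).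

Cell rh-split, seat rh-split-robin-finite g18 (brief sha16 f79c5f09d8bcb036), card `cards/SPLIT-robin-finite.md` §25; carved VERBATIM from the
kernel-checked object `HOME/rh-split-robin-finite/g18/SketchG18.lean` (sha16 71a1ab953989b3a4; `lean check` rc 0, 0 warnings, 0 sorries).  Zero `instance`,
zero `notation`, no attribute changes, no `native_decide` in this file; no `def … : Prop`; every conjecture / print fact appears only as an explicit
hypothesis (`Buthe2016_thm2`, `Buthe2018_thm2_theta`, `BroadbentEtAl2021_theta_rel_1e19`, `RiemannHypothesisUpTo T`).

THE LINE.  A colossally abundant `N = ∏ p^{a_p}` with largest prime `P` and structure prime `Q` (largest prime of exponent `≥ 2`) satisfies not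
only `log N ≥ θ(P) + θ(Q)` (the tree) but `log N ≥ θ(P) + θ(Q) + Λ` with `Λ = Σ_{j≥3} θ(x_j)` the higher storeys of the Alaoglu–Erdős staircase;
`Λ_K` is certified per dyadic piece `2^K ≤ P < 2^{K+1}` and spent on the analytic side as EXTRA zero-tail budget `d_k` on top of the tree's level
budgets `b_k` (`E_b` is affine in `b`; the gain `G₁^Λ − G₁` pays `d_k·w(P)`), so the SAME verified height `T` certifies a LONGER range of CA primes; the shift is
generic in its base (`key_ineq_shift`, part 5) and composes with the tree's `√`-window budgets `b'_k` (composition add-on, 2 files).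

HONEST LABEL: «SPLITTING SEARCH over kernel-typed RH-EQUIVALENCES; a splitting A ∧ B ⟹ RH is CONDITIONAL bookkeeping unless A and B
are both proved; nothing here bears on the truth of RH.»
-/

set_option linter.dupNamespace false

noncomputable section

open Real Finset
open scoped ArithmeticFunction.sigma Chebyshev

namespace Summit.RiemannHypothesis.RiemannHypothesis.Theorems.Splittings.RobinFiniteC1

section StaircaseSqrtCert

open Literature.NumberTheory.LFunctions Literature.NumberTheory.DiophantineGeometry
open RobinAnalyticSharp RobinAnalyticSharp.Cells
open Summit.RiemannHypothesis.RiemannHypothesis.Theorems.Splittings.RobinFiniteE3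
open Summit.RiemannHypothesis.RiemannHypothesis.Theorems.Splittings.RobinFiniteTail

/-! ### E″ · the compiled Riemann–Siegel certificate discharges `RH(10⁵)` in ROW SA

(`riemannHypothesisUpTo_100000`: standard axioms + the `native_decide` auxiliaries of the compiled chunk checks — proposal class
`computational`.) -/

/-- **ROW SA′ · the two θ-prints {Büthe 2018 Thm 2, BKLNW 2021 Table 15} + the tree's compiled RS certificate ⟹
Robin's inequality at every colossally abundant `N > 5040` all of whose primes are `≤ 5.83·10⁸`** (Part D `robinCA_below_stair_cert`:
`2.5·10⁸`). -/
theorem robinCA_below_stairS_cert (hB : Buthe2018_thm2_theta)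
    (hK : BroadbentEtAl2021_theta_rel_1e19) : robinCA_below 583000001 :=
  robinCA_below_stairS_100000 hB hK le_rfl riemannHypothesisUpTo_100000

/-- **ROW SA″ · all-integer currency of SA′: Robin's inequality for every `5040 < n ≤ 10^(25·10⁷)`** from the two θ-prints + the
compiled certificate (`2.5·10⁸·log 10 ≤ 0.99947·(5.83·10⁸ − 1)`; tree bridge `robin_all_of_robinCA_below_low`; Part D: `10^(10⁸)`). -/
theorem robin_le_of_certS (hB : Buthe2018_thm2_theta)
    (hK : BroadbentEtAl2021_theta_rel_1e19) : ∀ n : ℕ, 5040 < n → n ≤ 10 ^ (25 * 10 ^ 7) → robinInequality n := by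
  have hRB : robinCA_below (583000000 + 1) := robinCA_below_stairS_cert hB hK
  intro n hn hle
  have hn0 : 0 < n := lt_of_le_of_lt (Nat.zero_le 5040) hn
  have h1 : Real.log n ≤ ((25 * 10 ^ 7 : ℕ) : ℝ) * Real.log 10 := log_le_of_le_ten_pow hn0 hle
  clear hle
  refine robin_all_of_robinCA_below_low hB hK hRB (by norm_num) n hn ?_
  have h10 := RobinAnalytic.log_ten_lt
  have h9 : ((25 * 10 ^ 7 : ℕ) : ℝ) = 2.5e8 := by norm_num
  have hX : ((583000000 : ℕ) : ℝ) = 5.83e8 := by norm_num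
  rw [h9] at h1
  rw [hX]
  linarith

end StaircaseSqrtCert

end Summit.RiemannHypothesis.RiemannHypothesis.Theorems.Splittings.RobinFiniteC1

end
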